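import Literature.MathematicalPhysics.QuantumFieldTheory.Balaban1983to89.B10Eq27TorusAxialLog
import Literature.MathematicalPhysics.QuantumFieldTheory.Balaban1983to89.B4Eq19LatticeOperators
import Literature.MathematicalPhysics.QuantumFieldTheory.Balaban1983to89.T3ContinuumYM3Torus
import HarnessLib

/-!
# Route `UnitScaleTilt`, crux K1 «MinimiserStabilityRegPr» (stmt-QuantumFields-19200) — route-R E′ (A′), LANE II «DIVERGENCE RECOVERY AT CURVED `W`» (★★OWNER RULING №23),
# (B7) member geometry [I-9] «(Z-box)»: **THE ζ-SUPPORTS SIT INSIDE THE CHART BOX** — every fine site `x` of the member torus `Site (F.P K) 0` whose cyclic sup-distance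
# `min (x κ − c κ).val (c κ − x κ).val` to a centre `c` is `< D` in every direction is a chart point `transl c w` of an integer vector `w ∈ box z R` as soon as the box
# `[z − R, z + R]^d` contains `[1 − D, D − 1]^d`; the bond form (`w + e_μ ∈ box z R′`, `R + 1 ≤ R′`); the real-hypothesis form; and the RECORD INSTANCES for the radii of
# ★p1 g19's WORD №14 ∕ 09:51:32Z ask: `ℓ = L^{K−n}`, `R = L^s`, `z := fun _ => (ℓ − 1)∕2`, `R_f := (2R+1)·ℓ + (ℓ − 1)∕2`, supports `D = R·ℓ` (the p.o.u. `ζ_c` of ✓p705373) and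
# `D = (2R − 1)·ℓ` (the plateau cutoff `ζ̃_c` of ✓p710002) inside `box z (R_f − 2)`, inside-chart bonds in `box z R_f`; plus the two facts every user of that box needs:
# it is EXACTLY TILED by the `(4R+3)^d` blocks `b ∈ [−(2R+1), 2R+1]^d` of side `ℓ` (`ℓ` is odd), and `2R_f + 1 ≤ N₀` (`s < m + n`, `n ≤ K`, `2 ≤ L^s`) so that ✓p709960
# `transl_injOn_box` applies** (★p1 g19 ASK BY NAME → px9 g7, 2026-08-29 09:51:32Z; px12 g8 09:55:14Z «(Z-box) not moot»).

Cell `ym3-torus` ∕ width seat `ym3-torus-px9` (gen 7, «width 9»).  THEOREMS ONLY (0 `def`, 0 `sorry`); `--supports stmt-QuantumFields-19200 --as helper`, count-neutral.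
YM₃ on T³ is a ladder rung (R3), not d = 4, not the Clay problem; nothing here claims (B6), (B7), (REC), `hN06`, E′, EX or the gap.

WHY.  In the [I-9] assembly of the divergence-recovery row the cutoff package (✓p708961 `exists_cutoffPackage`: `ζ_c x ≠ 0 → ∀ κ, dist(x_κ, c_κ) < L^s·ℓ`) is read on the
member torus, while the local potential of (B8-member) (⧗p711072 `boxLocalPotential_member`) and the blockwise Poincaré knit (a′) state their rows on the CHART `transl c '' box z R_f`
(`hφZ`, `hD`, `κs` on `box z (R_f − 1)`).  The hinge is this file: wherever `ζ_c`∕`ζ̃_c ≠ 0` the point IS a chart point with two layers to spare, and every bond starting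
there is an inside-chart bond.  The witness is explicit: `w κ := (x κ − c κ).val` if that residue is `< D`, else `−(c κ − x κ).val`.

WHAT IS PROVED (ns `…Theorems.Prop7Lane2SupportInChart`):
* §1 (generic, any centre `c`, any `z R D`): ★★ `exists_mem_box_transl_eq` (sites), ★ `exists_mem_box_transl_eq_bond` (bonds: `… ∧ w + unitVec μ ∈ box z R′` for `R + 1 ≤ R′`),
  `exists_mem_box_transl_eq_of_lt_real` (hypothesis `((min …):ℝ) < X`, `X ≤ D`), ★★ `exists_mem_box_transl_eq_recentre` ∕ `…_bond_recentre` (ONE base chart `c₀` for all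
  patches: centre `c = transl c₀ w₀` ⇒ witness in `box (w₀ + z) R` of the base chart — the chart of ✓`QprimeCombL2_apply` is `c₀ = basePt F n K`).
* §2 (the record box, `ℓ = L^{K−n}`, `R = L^s`, `z = (ℓ−1)∕2`, `R_f = (2R+1)ℓ + (ℓ−1)∕2`, all in `ℤ` with `((F.L ^ _ : ℕ) : ℤ)` casts): ★★ `recordBox_eq_tiled` (the box is
  the tiled cube of ⧗p711632 `sum_tiled_sq_le_plaq` with `lo := fun _ => −(2R+1)`, `m := 4R+2`), ★ `two_mul_recordRadius_add_one_le` (`2R_f + 1 ≤ N₀`),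
  ★★★ `exists_mem_recordBox_of_dist_lt` ((i): `D = L^s·ℓ`, box `z (R_f − 2)`), ★★ `exists_mem_recordBox_of_dist_lt_plateau` ((ii): `((min …):ℝ) < (2L^s − 1)·ℓ`, the
  conclusion of ✓p710002 `dist_lt_of_plateauCutoff_ne_zero'`), ★★ `exists_mem_recordBox_bond` ((iii): `w ∈ box z (R_f − 2) ∧ w + unitVec b.dir ∈ box z R_f`),
  `recordBox_inner_subset` (`box z (R_f − 2) ⊆ box z (R_f − 1) ⊆ box z R_f`).
* §3 (the BASE chart, v3 — ★p1 g19 RECIPE v2 (A)): ★ `transl_valSub_eq` (`transl c₀ (val c − val c₀) = c`), ★★★ `exists_mem_blockBox_of_dist_lt` (support of radius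
  `D ≤ 2R·ℓ` around ANY centre `c` inside the block-TILED box `box zc (R_f − 2)` of any base chart `c₀`, `zc := ℓ·(w₀∕ℓ) + (ℓ−1)∕2`, `w₀ := val c − val c₀`),
  ★★ `blockBox_tiled` (its `hzlo`∕`hzhi` equations with `lo := B′ − (2R+1)`, `m := 4R+2`).
HONEST SCOPE.  Residue and interval bookkeeping; nothing of the lattice gauge theory, of print, of (B6)∕(B7)∕(REC)∕`hN06`∕the crux is asserted; rung R3, not Clay; YM gap NOT proved.

References: T. Bałaban, CMP 99 (1985) 389–434 [Balaban1985BackgroundPropagators] ((3.100) pp.413–414: partitions of unity at scale `M` on the torus and the local charts they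
live in); T. Bałaban, CMP 98 (1985) 17–51 [Balaban1985Averaging] (pp.24–25: the cubes `□` of the blockwise bounds); [folklore] (residues mod `N`, intervals).
-/

set_option autoImplicit false

namespace Summit.QuantumFields.YangMills.Theorems.Prop7Lane2SupportInChart

open Literature.MathematicalPhysics.QuantumFieldTheory.Balaban1983to89
open Literature.MathematicalPhysics.QuantumFieldTheory.Balaban1983to89.T3ContinuumYM3Torus
open Literature.MathematicalPhysics.QuantumFieldTheory.Balaban1983to89.B4Eq19LatticeOperators (Zd box unitVec mem_box box_mono add_unitVec_mem_box)
open B10Eq27TorusAxialLog (transl transl_apply)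

variable (F : T3Family) (n K s : ℕ)

/-! ## §1 Generic: a point near the centre is a chart point of the box -/

section Generic

/-- ★★ **A SITE WITHIN CYCLIC SUP-DISTANCE `D` OF THE CENTRE IS A CHART POINT OF EVERY BOX CONTAINING `[1 − D, D − 1]^d`**: the witness is `w κ := (x κ − c κ).val` when this
residue is `< D`, else `−(c κ − x κ).val`. [cite: Balaban1985BackgroundPropagators, (3.100) p.413] -/
theorem exists_mem_box_transl_eq (c x : Site (F.P K) 0) (z : Zd (F.P K).d) (R : ℤ) (D : ℕ)
    (hlo : ∀ κ, z κ - R ≤ 1 - (D : ℤ)) (hhi : ∀ κ, (D : ℤ) - 1 ≤ z κ + R)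
    (hx : ∀ κ, min (x κ - c κ).val (c κ - x κ).val < D) :
    ∃ w ∈ box z R, transl c w = x := by
  classical
  refine ⟨fun κ => if (x κ - c κ).val < D then ((x κ - c κ).val : ℤ) else -((c κ - x κ).val : ℤ), ?_, ?_⟩
  · rw [mem_box]
    intro κ
    have h1 := hlo κ
    have h2 := hhi κ
    by_cases h : (x κ - c κ).val < D
    · rw [if_pos h, abs_le]; constructor <;> omega
    · have h' : (c κ - x κ).val < D := (min_lt_iff.mp (hx κ)).resolve_left h
      rw [if_neg h, abs_le]; constructor <;> omega
  · funext κ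
    rw [transl_apply]
    by_cases h : (x κ - c κ).val < D
    · rw [if_pos h, Int.cast_natCast, ZMod.natCast_zmod_val]; abel
    · rw [if_neg h, Int.cast_neg, Int.cast_natCast, ZMod.natCast_zmod_val]; abel

/-- ★ **BOND FORM**: under the same hypotheses at `b.src`, the bond `b` is an inside-chart bond of every box one layer larger. [cite: Balaban1985BackgroundPropagators, (3.100) p.413] -/
theorem exists_mem_box_transl_eq_bond (c : Site (F.P K) 0) (z : Zd (F.P K).d) (R R' : ℤ) (hRR' : R + 1 ≤ R') (D : ℕ)
    (hlo : ∀ κ, z κ - R ≤ 1 - (D : ℤ)) (hhi : ∀ κ, (D : ℤ) - 1 ≤ z κ + R) (b : PBond (F.P K) 0)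
    (hx : ∀ κ, min (b.src κ - c κ).val (c κ - b.src κ).val < D) :
    ∃ w ∈ box z R, transl c w = b.src ∧ w + unitVec b.dir ∈ box z R' := by
  obtain ⟨w, hw, he⟩ := exists_mem_box_transl_eq F K c b.src z R D hlo hhi hx
  exact ⟨w, hw, he, box_mono z hRR' (add_unitVec_mem_box hw b.dir)⟩

/-- **REAL-HYPOTHESIS FORM**: a strict real bound `X ≤ D` on the cast distances suffices (the shape of the support rows of the cutoffs). [folklore] -/
theorem exists_mem_box_transl_eq_of_lt_real (c x : Site (F.P K) 0) (z : Zd (F.P K).d) (R : ℤ) (D : ℕ)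
    (hlo : ∀ κ, z κ - R ≤ 1 - (D : ℤ)) (hhi : ∀ κ, (D : ℤ) - 1 ≤ z κ + R) {X : ℝ} (hX : X ≤ (D : ℝ))
    (hx : ∀ κ, ((min (x κ - c κ).val (c κ - x κ).val : ℕ) : ℝ) < X) :
    ∃ w ∈ box z R, transl c w = x :=
  exists_mem_box_transl_eq F K c x z R D hlo hhi fun κ => by
    have h := (hx κ).trans_le hX
    exact_mod_cast h

/-- ★★ **RE-CENTRED FORM** (one chart for all patches): if the distance centre `c` is itself a chart point `transl c₀ w₀` of a base chart `c₀` (e.g. `c₀ = basePt F n K`, the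
chart of ✓`QprimeCombL2_apply`), the witness lives in the translated box `box (w₀ + z) R` of the BASE chart. [cite: Balaban1985BackgroundPropagators, (3.100) p.413] -/
theorem exists_mem_box_transl_eq_recentre (c₀ c x : Site (F.P K) 0) (w₀ : Zd (F.P K).d) (hc : transl c₀ w₀ = c) (z : Zd (F.P K).d) (R : ℤ) (D : ℕ)
    (hlo : ∀ κ, z κ - R ≤ 1 - (D : ℤ)) (hhi : ∀ κ, (D : ℤ) - 1 ≤ z κ + R)
    (hx : ∀ κ, min (x κ - c κ).val (c κ - x κ).val < D) :
    ∃ w ∈ box (w₀ + z) R, transl c₀ w = x := by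
  obtain ⟨u, hu, he⟩ := exists_mem_box_transl_eq F K c x z R D hlo hhi hx
  refine ⟨w₀ + u, ?_, ?_⟩
  · rw [mem_box] at hu ⊢
    intro i
    have h := hu i
    simp only [Pi.add_apply]
    rwa [show w₀ i + u i - (w₀ i + z i) = u i - z i by ring]
  · rw [← he, ← hc]
    funext ν
    simp only [transl_apply, Pi.add_apply, Int.cast_add]
    ring

/-- ★ **RE-CENTRED BOND FORM**. [cite: Balaban1985BackgroundPropagators, (3.100) p.413] -/
theorem exists_mem_box_transl_eq_bond_recentre (c₀ c : Site (F.P K) 0) (w₀ : Zd (F.P K).d) (hc : transl c₀ w₀ = c) (z : Zd (F.P K).d) (R R' : ℤ)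
    (hRR' : R + 1 ≤ R') (D : ℕ) (hlo : ∀ κ, z κ - R ≤ 1 - (D : ℤ)) (hhi : ∀ κ, (D : ℤ) - 1 ≤ z κ + R) (b : PBond (F.P K) 0)
    (hx : ∀ κ, min (b.src κ - c κ).val (c κ - b.src κ).val < D) :
    ∃ w ∈ box (w₀ + z) R, transl c₀ w = b.src ∧ w + unitVec b.dir ∈ box (w₀ + z) R' := by
  obtain ⟨w, hw, he⟩ := exists_mem_box_transl_eq_recentre F K c₀ c b.src w₀ hc z R D hlo hhi hx
  exact ⟨w, hw, he, box_mono _ hRR' (add_unitVec_mem_box hw b.dir)⟩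

end Generic

/-! ## §2 The record box: `ℓ = L^{K−n}`, `R = L^s`, `z = (ℓ−1)∕2`, `R_f = (2R+1)ℓ + (ℓ−1)∕2` -/

section Record

/-- `L^{K−n}` is odd (the family's `L` is odd). [folklore] -/
theorem odd_pow_level : Odd (F.L ^ (K - n)) := F.hL.1.pow

/-- ★★ **THE RECORD BOX IS BLOCK-TILED**: `box z R_f` is the cube of the `(4R+3)^d` blocks `b ∈ [−(2R+1), 2R+1]^d` of side `ℓ` — the `Ωf` of the tiled-cube Poincaré
inequality with `lo := fun _ => −(2R+1)`, `m := 4R+2` (uses `ℓ` odd). [cite: Balaban1985Averaging, pp.24-25] -/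
theorem recordBox_eq_tiled :
    Fintype.piFinset (fun i : Fin (F.P K).d => Finset.Icc
        (((F.L ^ (K - n) : ℕ) : ℤ) * (fun _ : Fin (F.P K).d => -(2 * ((F.L ^ s : ℕ) : ℤ) + 1)) i)
        (((F.L ^ (K - n) : ℕ) : ℤ) * (fun _ : Fin (F.P K).d => -(2 * ((F.L ^ s : ℕ) : ℤ) + 1)) i
          + (((4 * F.L ^ s + 2 + 1) * F.L ^ (K - n) - 1 : ℕ) : ℤ)))
      = box (fun _ : Fin (F.P K).d => (((F.L ^ (K - n) : ℕ) : ℤ) - 1) / 2)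
          ((2 * ((F.L ^ s : ℕ) : ℤ) + 1) * ((F.L ^ (K - n) : ℕ) : ℤ) + (((F.L ^ (K - n) : ℕ) : ℤ) - 1) / 2) := by
  obtain ⟨k, hk⟩ := odd_pow_level F n K
  have hL : 0 < F.L := by have := F.hL.2; omega
  have hR1 : 1 ≤ F.L ^ s := Nat.one_le_pow _ _ hL
  obtain ⟨P, hP⟩ : ∃ P : ℤ, P = ((F.L ^ s : ℕ) : ℤ) * ((F.L ^ (K - n) : ℕ) : ℤ) := ⟨_, rfl⟩
  have e1 : ((F.L ^ (K - n) : ℕ) : ℤ) * (-(2 * ((F.L ^ s : ℕ) : ℤ) + 1)) = -(2 * P) - ((F.L ^ (K - n) : ℕ) : ℤ) := by rw [hP]; ring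
  have e2 : (((4 * F.L ^ s + 2 + 1) * F.L ^ (K - n) - 1 : ℕ) : ℤ) = 4 * P + 3 * ((F.L ^ (K - n) : ℕ) : ℤ) - 1 := by
    have h1 : 1 ≤ (4 * F.L ^ s + 2 + 1) * F.L ^ (K - n) := Nat.one_le_iff_ne_zero.mpr (by positivity)
    rw [Nat.cast_sub h1]; push_cast; rw [hP]; push_cast; ring
  have e3 : (2 * ((F.L ^ s : ℕ) : ℤ) + 1) * ((F.L ^ (K - n) : ℕ) : ℤ) = 2 * P + ((F.L ^ (K - n) : ℕ) : ℤ) := by rw [hP]; ring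
  have hk' : ((F.L ^ (K - n) : ℕ) : ℤ) = 2 * k + 1 := by exact_mod_cast hk
  ext w
  simp only [Fintype.mem_piFinset, Finset.mem_Icc, mem_box]
  refine forall_congr' fun i => ?_
  rw [e1, e2, e3, hk', abs_le]
  constructor
  · rintro ⟨h1, h2⟩; constructor <;> omega
  · rintro ⟨h1, h2⟩; constructor <;> omega

/-- ★ **THE RECORD BOX FITS IN THE TORUS**: `2R_f + 1 ≤ N₀` (`= 2L^{m+K}`) whenever `s < m + n`, `n ≤ K`, `2 ≤ L^s` — the hypothesis of ✓p709960 `transl_injOn_box` ∕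
`sum_site_eq_sum_box`. [folklore] -/
theorem two_mul_recordRadius_add_one_le (hnK : n ≤ K) (hs : s < F.m + n) (hR2 : 2 ≤ F.L ^ s) :
    2 * ((2 * ((F.L ^ s : ℕ) : ℤ) + 1) * ((F.L ^ (K - n) : ℕ) : ℤ) + (((F.L ^ (K - n) : ℕ) : ℤ) - 1) / 2) + 1 ≤ ((F.P K).sitesPerDir 0 : ℤ) := by
  obtain ⟨k, hk⟩ := odd_pow_level F n K
  obtain ⟨j, hj⟩ := F.hL.1
  have hL3 : 3 ≤ F.L := by have := F.hL.2; omega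
  have hN : (F.P K).sitesPerDir 0 = 2 * F.L ^ (F.m + K - 0) := rfl
  have hpow : F.L ^ (F.m + K - 0) = F.L ^ (F.m + n - s - 1) * F.L * (F.L ^ s * F.L ^ (K - n)) := by
    rw [← pow_succ, ← pow_add, ← pow_add]; congr 1; omega
  have h6 : 6 * (F.L ^ s * F.L ^ (K - n)) ≤ (F.P K).sitesPerDir 0 := by
    rw [hN, hpow]
    have h1 : 1 ≤ F.L ^ (F.m + n - s - 1) := Nat.one_le_pow _ _ (by omega)
    calc 6 * (F.L ^ s * F.L ^ (K - n)) = 2 * (1 * 3 * (F.L ^ s * F.L ^ (K - n))) := by ring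
      _ ≤ 2 * (F.L ^ (F.m + n - s - 1) * F.L * (F.L ^ s * F.L ^ (K - n))) := by gcongr
  have h3 : 3 * F.L ^ (K - n) ≤ 2 * (F.L ^ s * F.L ^ (K - n)) := by
    rw [← mul_assoc]; exact Nat.mul_le_mul_right _ (by omega)
  have h6' : (6 : ℤ) * (((F.L ^ s : ℕ) : ℤ) * ((F.L ^ (K - n) : ℕ) : ℤ)) ≤ ((F.P K).sitesPerDir 0 : ℤ) := by exact_mod_cast h6
  have h3' : (3 : ℤ) * ((F.L ^ (K - n) : ℕ) : ℤ) ≤ 2 * (((F.L ^ s : ℕ) : ℤ) * ((F.L ^ (K - n) : ℕ) : ℤ)) := by exact_mod_cast h3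
  have hk' : ((F.L ^ (K - n) : ℕ) : ℤ) = 2 * k + 1 := by exact_mod_cast hk
  have e : (2 * ((F.L ^ s : ℕ) : ℤ) + 1) * ((F.L ^ (K - n) : ℕ) : ℤ) = 2 * (((F.L ^ s : ℕ) : ℤ) * ((F.L ^ (K - n) : ℕ) : ℤ)) + ((F.L ^ (K - n) : ℕ) : ℤ) := by ring
  rw [e]
  generalize ((F.L ^ s : ℕ) : ℤ) * ((F.L ^ (K - n) : ℕ) : ℤ) = P at h6' h3' ⊢
  omega

/-- `box z (R_f − 2) ⊆ box z (R_f − 1) ⊆ box z R_f` (the interior readings of (B8-member)). [folklore] -/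
theorem recordBox_inner_subset (z : Zd (F.P K).d) (Rf : ℤ) : box z (Rf - 2) ⊆ box z (Rf - 1) ∧ box z (Rf - 1) ⊆ box z Rf :=
  ⟨box_mono z (by omega), box_mono z (by omega)⟩

/-- ★★★ **(Z-box)(i) — THE p.o.u. SUPPORT SITS INSIDE THE CHART BOX WITH TWO LAYERS TO SPARE**: `(∀ κ, dist(x_κ, c_κ) < L^s·ℓ) → ∃ w ∈ box z (R_f − 2), transl c w = x`
(the hypothesis is ✓p708961∕✓p705373's support row `ζ_c x ≠ 0 → …`). [cite: Balaban1985BackgroundPropagators, (3.100) p.413] -/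
theorem exists_mem_recordBox_of_dist_lt (c x : Site (F.P K) 0)
    (hx : ∀ κ, min (x κ - c κ).val (c κ - x κ).val < F.L ^ s * F.L ^ (K - n)) :
    ∃ w ∈ box (fun _ : Fin (F.P K).d => (((F.L ^ (K - n) : ℕ) : ℤ) - 1) / 2)
        ((2 * ((F.L ^ s : ℕ) : ℤ) + 1) * ((F.L ^ (K - n) : ℕ) : ℤ) + (((F.L ^ (K - n) : ℕ) : ℤ) - 1) / 2 - 2),
      transl c w = x := by
  have hL : 0 < F.L := by have := F.hL.2; omega
  have hR1 : 1 ≤ F.L ^ s := Nat.one_le_pow _ _ hL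
  have hℓ1 : 1 ≤ F.L ^ (K - n) := Nat.one_le_pow _ _ hL
  have hR1' : (1 : ℤ) ≤ ((F.L ^ s : ℕ) : ℤ) := by exact_mod_cast hR1
  have hℓ1' : (1 : ℤ) ≤ ((F.L ^ (K - n) : ℕ) : ℤ) := by exact_mod_cast hℓ1
  have hP1 : ((F.L ^ (K - n) : ℕ) : ℤ) ≤ ((F.L ^ s : ℕ) : ℤ) * ((F.L ^ (K - n) : ℕ) : ℤ) := le_mul_of_one_le_left (by omega) hR1'
  refine exists_mem_box_transl_eq F K c x _ _ (F.L ^ s * F.L ^ (K - n)) (fun κ => ?_) (fun κ => ?_) hx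
  · have e : (2 * ((F.L ^ s : ℕ) : ℤ) + 1) * ((F.L ^ (K - n) : ℕ) : ℤ) = 2 * (((F.L ^ s : ℕ) : ℤ) * ((F.L ^ (K - n) : ℕ) : ℤ)) + ((F.L ^ (K - n) : ℕ) : ℤ) := by ring
    rw [e]; simp only [Nat.cast_mul]
    generalize ((F.L ^ s : ℕ) : ℤ) * ((F.L ^ (K - n) : ℕ) : ℤ) = P at hP1 ⊢
    omega
  · have e : (2 * ((F.L ^ s : ℕ) : ℤ) + 1) * ((F.L ^ (K - n) : ℕ) : ℤ) = 2 * (((F.L ^ s : ℕ) : ℤ) * ((F.L ^ (K - n) : ℕ) : ℤ)) + ((F.L ^ (K - n) : ℕ) : ℤ) := by ring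
    rw [e]; simp only [Nat.cast_mul]
    generalize ((F.L ^ s : ℕ) : ℤ) * ((F.L ^ (K - n) : ℕ) : ℤ) = P at hP1 ⊢
    omega

/-- ★★ **(Z-box)(ii) — THE PLATEAU CUTOFF'S SUPPORT SITS INSIDE THE CHART BOX WITH TWO LAYERS TO SPARE**: `(∀ κ, (dist(x_κ, c_κ) : ℝ) < (2L^s − 1)·ℓ) →
∃ w ∈ box z (R_f − 2), transl c w = x` (the hypothesis is ✓p710002 `dist_lt_of_plateauCutoff_ne_zero'`'s conclusion). [cite: Balaban1985BackgroundPropagators, (3.100) p.413] -/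
theorem exists_mem_recordBox_of_dist_lt_plateau (c x : Site (F.P K) 0)
    (hx : ∀ κ : Fin 3, ((min (x κ - c κ).val (c κ - x κ).val : ℕ) : ℝ) < (2 * (F.L : ℝ) ^ s - 1) * (F.L : ℝ) ^ (K - n)) :
    ∃ w ∈ box (fun _ : Fin (F.P K).d => (((F.L ^ (K - n) : ℕ) : ℤ) - 1) / 2)
        ((2 * ((F.L ^ s : ℕ) : ℤ) + 1) * ((F.L ^ (K - n) : ℕ) : ℤ) + (((F.L ^ (K - n) : ℕ) : ℤ) - 1) / 2 - 2),
      transl c w = x := by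
  have hL : 0 < F.L := by have := F.hL.2; omega
  have hR1 : 1 ≤ F.L ^ s := Nat.one_le_pow _ _ hL
  have hℓ1 : 1 ≤ F.L ^ (K - n) := Nat.one_le_pow _ _ hL
  have hℓ1' : (1 : ℤ) ≤ ((F.L ^ (K - n) : ℕ) : ℤ) := by exact_mod_cast hℓ1
  have hX : (2 * (F.L : ℝ) ^ s - 1) * (F.L : ℝ) ^ (K - n) ≤ (((2 * F.L ^ s - 1) * F.L ^ (K - n) : ℕ) : ℝ) := by
    have h2 : 1 ≤ 2 * F.L ^ s := by omega
    push_cast [Nat.cast_sub h2]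
    exact le_rfl
  refine exists_mem_box_transl_eq_of_lt_real F K c x _ _ ((2 * F.L ^ s - 1) * F.L ^ (K - n)) (fun κ => ?_) (fun κ => ?_) hX hx
  · have h2 : 1 ≤ 2 * F.L ^ s := by omega
    have e : (2 * ((F.L ^ s : ℕ) : ℤ) + 1) * ((F.L ^ (K - n) : ℕ) : ℤ) = 2 * (((F.L ^ s : ℕ) : ℤ) * ((F.L ^ (K - n) : ℕ) : ℤ)) + ((F.L ^ (K - n) : ℕ) : ℤ) := by ring
    have e' : (((2 * F.L ^ s - 1) * F.L ^ (K - n) : ℕ) : ℤ) = 2 * (((F.L ^ s : ℕ) : ℤ) * ((F.L ^ (K - n) : ℕ) : ℤ)) - ((F.L ^ (K - n) : ℕ) : ℤ) := by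
      rw [Nat.cast_mul, Nat.cast_sub h2]; push_cast; ring
    rw [e, e']
    generalize ((F.L ^ s : ℕ) : ℤ) * ((F.L ^ (K - n) : ℕ) : ℤ) = P
    omega
  · have h2 : 1 ≤ 2 * F.L ^ s := by omega
    have e : (2 * ((F.L ^ s : ℕ) : ℤ) + 1) * ((F.L ^ (K - n) : ℕ) : ℤ) = 2 * (((F.L ^ s : ℕ) : ℤ) * ((F.L ^ (K - n) : ℕ) : ℤ)) + ((F.L ^ (K - n) : ℕ) : ℤ) := by ring
    have e' : (((2 * F.L ^ s - 1) * F.L ^ (K - n) : ℕ) : ℤ) = 2 * (((F.L ^ s : ℕ) : ℤ) * ((F.L ^ (K - n) : ℕ) : ℤ)) - ((F.L ^ (K - n) : ℕ) : ℤ) := by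
      rw [Nat.cast_mul, Nat.cast_sub h2]; push_cast; ring
    rw [e, e']
    generalize ((F.L ^ s : ℕ) : ℤ) * ((F.L ^ (K - n) : ℕ) : ℤ) = P
    omega

/-- ★★ **(Z-box)(iii) — BONDS STARTING ON THE p.o.u. SUPPORT ARE INSIDE-CHART BONDS**: under (i)'s hypothesis at `b.src`,
`∃ w ∈ box z (R_f − 2), transl c w = b.src ∧ w + unitVec b.dir ∈ box z R_f` (so (B8-member)'s inside-chart conjuncts apply wherever `ζ_c ≠ 0`).
[cite: Balaban1985BackgroundPropagators, (3.100) p.413] -/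
theorem exists_mem_recordBox_bond (c : Site (F.P K) 0) (b : PBond (F.P K) 0)
    (hx : ∀ κ, min (b.src κ - c κ).val (c κ - b.src κ).val < F.L ^ s * F.L ^ (K - n)) :
    ∃ w ∈ box (fun _ : Fin (F.P K).d => (((F.L ^ (K - n) : ℕ) : ℤ) - 1) / 2)
        ((2 * ((F.L ^ s : ℕ) : ℤ) + 1) * ((F.L ^ (K - n) : ℕ) : ℤ) + (((F.L ^ (K - n) : ℕ) : ℤ) - 1) / 2 - 2),
      transl c w = b.src ∧
      w + unitVec b.dir ∈ box (fun _ : Fin (F.P K).d => (((F.L ^ (K - n) : ℕ) : ℤ) - 1) / 2)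
        ((2 * ((F.L ^ s : ℕ) : ℤ) + 1) * ((F.L ^ (K - n) : ℕ) : ℤ) + (((F.L ^ (K - n) : ℕ) : ℤ) - 1) / 2) := by
  obtain ⟨w, hw, he⟩ := exists_mem_recordBox_of_dist_lt F n K s c b.src hx
  exact ⟨w, hw, he, box_mono _ (by omega) (add_unitVec_mem_box hw b.dir)⟩

end Record


/-! ## §3 The base chart: any centre `c` read in a fixed chart `c₀`, with a block-tiled box around it -/

section BaseChart

/-- ★ **EVERY SITE IS A CHART POINT OF EVERY BASE CHART, EXPLICITLY**: `transl c₀ (val c − val c₀) = c`. [folklore] -/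
theorem transl_valSub_eq (c₀ c : Site (F.P K) 0) :
    transl c₀ (fun κ => (((c κ).val : ℕ) : ℤ) - (((c₀ κ).val : ℕ) : ℤ)) = c := by
  funext κ
  rw [transl_apply, Int.cast_sub, Int.cast_natCast, Int.cast_natCast, ZMod.natCast_zmod_val, ZMod.natCast_zmod_val]
  abel

/-- ★★★ **(Z-box) IN THE BASE CHART** (★p1 g19 RECIPE v2 (A): one chart `c₀ = basePt F n K` for all patches): with `w₀ := val c − val c₀`, the block vector
`B′ κ := w₀ κ ∕ ℓ` and the BLOCK-TILED box centre `zc κ := ℓ·B′ κ + (ℓ−1)∕2` (so `box zc R_f` is the cube of the comb blocks `b ∈ B′ + [−(2R+1), 2R+1]^d`: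
`zc − R_f = ℓ·(B′ − (2R+1))`, `zc + R_f = ℓ·(B′ − (2R+1)) + (4R+3)ℓ − 1`), every site within cyclic sup-distance `D ≤ 2R·ℓ` of `c` is `transl c₀ w` for some
`w ∈ box zc (R_f − 2)` — the centre `c` sits in block `B′`, at most half a block from `zc`, and one block of slack absorbs it. [cite: Balaban1985BackgroundPropagators, (3.100) p.413] -/
theorem exists_mem_blockBox_of_dist_lt (c₀ c x : Site (F.P K) 0) (D : ℕ) (hD : D ≤ 2 * F.L ^ s * F.L ^ (K - n))
    (hx : ∀ κ, min (x κ - c κ).val (c κ - x κ).val < D) :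
    ∃ w ∈ box (fun κ : Fin (F.P K).d => ((F.L ^ (K - n) : ℕ) : ℤ) *
          (((((c κ).val : ℕ) : ℤ) - (((c₀ κ).val : ℕ) : ℤ)) / ((F.L ^ (K - n) : ℕ) : ℤ)) + (((F.L ^ (K - n) : ℕ) : ℤ) - 1) / 2)
        ((2 * ((F.L ^ s : ℕ) : ℤ) + 1) * ((F.L ^ (K - n) : ℕ) : ℤ) + (((F.L ^ (K - n) : ℕ) : ℤ) - 1) / 2 - 2),
      transl c₀ w = x := by
  have hL : 0 < F.L := by have := F.hL.2; omega
  have hR1 : 1 ≤ F.L ^ s := Nat.one_le_pow _ _ hL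
  have hℓ1 : 1 ≤ F.L ^ (K - n) := Nat.one_le_pow _ _ hL
  have hℓ1' : (1 : ℤ) ≤ ((F.L ^ (K - n) : ℕ) : ℤ) := by exact_mod_cast hℓ1
  have hℓ0 : (0 : ℤ) < ((F.L ^ (K - n) : ℕ) : ℤ) := by omega
  have hD' : (D : ℤ) ≤ 2 * (((F.L ^ s : ℕ) : ℤ) * ((F.L ^ (K - n) : ℕ) : ℤ)) := by exact_mod_cast (by simpa [mul_assoc] using hD)
  -- the re-centred generic row with `z := zc − w₀`
  have key := exists_mem_box_transl_eq_recentre F K c₀ c x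
    (fun κ => (((c κ).val : ℕ) : ℤ) - (((c₀ κ).val : ℕ) : ℤ)) (transl_valSub_eq F K c₀ c)
    (fun κ => ((F.L ^ (K - n) : ℕ) : ℤ) * (((((c κ).val : ℕ) : ℤ) - (((c₀ κ).val : ℕ) : ℤ)) / ((F.L ^ (K - n) : ℕ) : ℤ))
        + (((F.L ^ (K - n) : ℕ) : ℤ) - 1) / 2 - ((((c κ).val : ℕ) : ℤ) - (((c₀ κ).val : ℕ) : ℤ)))
    ((2 * ((F.L ^ s : ℕ) : ℤ) + 1) * ((F.L ^ (K - n) : ℕ) : ℤ) + (((F.L ^ (K - n) : ℕ) : ℤ) - 1) / 2 - 2) D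
    (fun κ => ?_) (fun κ => ?_) hx
  · obtain ⟨w, hw, he⟩ := key
    refine ⟨w, ?_, he⟩
    have e : (fun κ => ((((c κ).val : ℕ) : ℤ) - (((c₀ κ).val : ℕ) : ℤ))) +
        (fun κ => ((F.L ^ (K - n) : ℕ) : ℤ) * (((((c κ).val : ℕ) : ℤ) - (((c₀ κ).val : ℕ) : ℤ)) / ((F.L ^ (K - n) : ℕ) : ℤ))
          + (((F.L ^ (K - n) : ℕ) : ℤ) - 1) / 2 - ((((c κ).val : ℕ) : ℤ) - (((c₀ κ).val : ℕ) : ℤ)))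
        = fun κ : Fin (F.P K).d => ((F.L ^ (K - n) : ℕ) : ℤ) *
          (((((c κ).val : ℕ) : ℤ) - (((c₀ κ).val : ℕ) : ℤ)) / ((F.L ^ (K - n) : ℕ) : ℤ)) + (((F.L ^ (K - n) : ℕ) : ℤ) - 1) / 2 := by
      funext κ; simp only [Pi.add_apply]; ring
    rw [e] at hw
    exact hw
  · -- lower margin: `z κ − (R_f − 2) ≤ 1 − D`
    have hdiv := Int.emod_add_mul_ediv ((((c κ).val : ℕ) : ℤ) - (((c₀ κ).val : ℕ) : ℤ)) ((F.L ^ (K - n) : ℕ) : ℤ)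
    have hm0 := Int.emod_nonneg ((((c κ).val : ℕ) : ℤ) - (((c₀ κ).val : ℕ) : ℤ)) hℓ0.ne'
    have hm1 := Int.emod_lt_of_pos ((((c κ).val : ℕ) : ℤ) - (((c₀ κ).val : ℕ) : ℤ)) hℓ0
    have e : (2 * ((F.L ^ s : ℕ) : ℤ) + 1) * ((F.L ^ (K - n) : ℕ) : ℤ) = 2 * (((F.L ^ s : ℕ) : ℤ) * ((F.L ^ (K - n) : ℕ) : ℤ)) + ((F.L ^ (K - n) : ℕ) : ℤ) := by ring
    rw [e]
    generalize ((F.L ^ s : ℕ) : ℤ) * ((F.L ^ (K - n) : ℕ) : ℤ) = P at hD' ⊢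
    generalize ((F.L ^ (K - n) : ℕ) : ℤ) * (((((c κ).val : ℕ) : ℤ) - (((c₀ κ).val : ℕ) : ℤ)) / ((F.L ^ (K - n) : ℕ) : ℤ)) = Q at hdiv ⊢
    omega
  · have hdiv := Int.emod_add_mul_ediv ((((c κ).val : ℕ) : ℤ) - (((c₀ κ).val : ℕ) : ℤ)) ((F.L ^ (K - n) : ℕ) : ℤ)
    have hm0 := Int.emod_nonneg ((((c κ).val : ℕ) : ℤ) - (((c₀ κ).val : ℕ) : ℤ)) hℓ0.ne'
    have hm1 := Int.emod_lt_of_pos ((((c κ).val : ℕ) : ℤ) - (((c₀ κ).val : ℕ) : ℤ)) hℓ0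
    have e : (2 * ((F.L ^ s : ℕ) : ℤ) + 1) * ((F.L ^ (K - n) : ℕ) : ℤ) = 2 * (((F.L ^ s : ℕ) : ℤ) * ((F.L ^ (K - n) : ℕ) : ℤ)) + ((F.L ^ (K - n) : ℕ) : ℤ) := by ring
    rw [e]
    generalize ((F.L ^ s : ℕ) : ℤ) * ((F.L ^ (K - n) : ℕ) : ℤ) = P at hD' ⊢
    generalize ((F.L ^ (K - n) : ℕ) : ℤ) * (((((c κ).val : ℕ) : ℤ) - (((c₀ κ).val : ℕ) : ℤ)) / ((F.L ^ (K - n) : ℕ) : ℤ)) = Q at hdiv ⊢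
    omega

/-- ★★ **THE BLOCK BOX IS TILED**: the two defining equations of the knit's `(z, R_f, lo, m)` for the base-chart box of any centre — `zc − R_f = ℓ·lo`,
`zc + R_f = ℓ·lo + ((4R+3)ℓ − 1)` with `lo := B′ − (2R+1)`, `m := 4R+2` (`ℓ` odd). [cite: Balaban1985Averaging, pp.24-25] -/
theorem blockBox_tiled (B' : Zd (F.P K).d) (κ : Fin (F.P K).d) :
    (((F.L ^ (K - n) : ℕ) : ℤ) * B' κ + (((F.L ^ (K - n) : ℕ) : ℤ) - 1) / 2)
        - ((2 * ((F.L ^ s : ℕ) : ℤ) + 1) * ((F.L ^ (K - n) : ℕ) : ℤ) + (((F.L ^ (K - n) : ℕ) : ℤ) - 1) / 2)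
      = ((F.L ^ (K - n) : ℕ) : ℤ) * (B' κ - (2 * ((F.L ^ s : ℕ) : ℤ) + 1)) ∧
    (((F.L ^ (K - n) : ℕ) : ℤ) * B' κ + (((F.L ^ (K - n) : ℕ) : ℤ) - 1) / 2)
        + ((2 * ((F.L ^ s : ℕ) : ℤ) + 1) * ((F.L ^ (K - n) : ℕ) : ℤ) + (((F.L ^ (K - n) : ℕ) : ℤ) - 1) / 2)
      = ((F.L ^ (K - n) : ℕ) : ℤ) * (B' κ - (2 * ((F.L ^ s : ℕ) : ℤ) + 1)) + (((4 * F.L ^ s + 2 + 1) * F.L ^ (K - n) - 1 : ℕ) : ℤ) := by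
  obtain ⟨k, hk⟩ := odd_pow_level F n K
  have hk' : ((F.L ^ (K - n) : ℕ) : ℤ) = 2 * k + 1 := by exact_mod_cast hk
  have hL : 0 < F.L := by have := F.hL.2; omega
  have h1 : 1 ≤ (4 * F.L ^ s + 2 + 1) * F.L ^ (K - n) := Nat.one_le_iff_ne_zero.mpr (by positivity)
  have e2 : (((4 * F.L ^ s + 2 + 1) * F.L ^ (K - n) - 1 : ℕ) : ℤ) = (4 * ((F.L ^ s : ℕ) : ℤ) + 3) * ((F.L ^ (K - n) : ℕ) : ℤ) - 1 := by
    rw [Nat.cast_sub h1]; push_cast; ring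
  have hdiv : ((((F.L ^ (K - n) : ℕ) : ℤ) - 1) / 2) = k := by rw [hk']; omega
  refine ⟨by ring, ?_⟩
  rw [e2, hdiv, hk']
  ring

end BaseChart

end Summit.QuantumFields.YangMills.Theorems.Prop7Lane2SupportInChart
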